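import Summits.Ventures.CertifiedManyBodySolver.Downfold.EmeryOrbitalWeightNode
import Summits.Ventures.CertifiedManyBodySolver.Downfold.EmeryFermiEnergyExistsAll
import HarnessLib

/-!
# The NODAL Fermi-surface Cu-d weight OVER A TYPED BOX — the four one-coordinate levers of the closed form and the TWO-CORNER RULE
# (the kinematic leg of the band-level `U` annex of INFL-3to1-B §B.72, read over a box: §B.89 (c) «the U-leg budget»)

Venture CertifiedManyBodySolver, cell `pub/hubbard-downfold` (stage S1; INFLATION-RULES-3to1-B §B.72 (h), §B.89 (c)), seat hubbard-downfold-mod-4 (technique B, g37);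
namespace `Summit.Ventures.CertifiedManyBodySolver.Downfold.Emery`. Sequel of `EmeryOrbitalWeightNode` (`dWeightNode_eq`: the Cu-d weight of the nodal Bloch state
of the `ε`-contour is `2t_pd²(Δ + ε)/(2t_pd²(Δ + 2ε) + (t_pp − t_pp′)ε²)`, strictly decreasing in `ε`) and of the certificate-free Fermi-energy box rule
`fermiEnergyOf_mem_Icc_of_mem_box'` (`EmeryFermiEnergyExistsAll`). Everything PROVED (0 sorry; elementary algebra of one rational function).
WHAT THIS IS NOT: a statement about any material; `U = 0` one-body kinematics of the σ (d–pₓ–p_y + t_pp + t_pp′) model; the weight enters the band-level `U` ANNEX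
`U_B(w) = w²U_dd + (1 − w)²U_pp/4 + 2w(1 − w)U_dp` (`EmeryBandLevelU`, a mean-field projection — EXTRAPOLATED-grade context by R-B17, never a box member).

* §1 `dWeightNodeCF Δ t_pd g ε = 2t_pd²(Δ + ε)/(2t_pd²(Δ + 2ε) + gε²)` (the closed form as a function of `g = t_pp − t_pp′`); `dWeightNode = dWeightNodeCF` in the regime.
* §2 THE FOUR LEVERS at fixed energy and the energy lever, each by ONE cross-multiplication identity: **non-decreasing in `Δ`** (`N(Δ)D(Δ′) − N(Δ′)D(Δ) =
  2t_pd²·ε·(Δ − Δ′)·(2t_pd² + gε)`), **non-decreasing in `t_pd²`** (`= (Δ + ε)gε²(T − T′)`), **non-increasing in `g = t_pp − t_pp′`** (hence ↓ in `t_pp`, ↑ in `t_pp′`),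
  **non-increasing in `ε`** (`EmeryOrbitalWeightNode` §3).
* §3 THE TWO-CORNER RULE: for every member `θ = (Δ, t_pd, t_pp, t_pp′)` of `[Δ₁, Δ₂] × [a₁, a₂] × [b₁, b₂] × [c₁, c₂]` (`Δ₁ > 0`, `a₁ > 0`, `0 ≤ c₁`, `c₂ ≤ b₁`) at filling
  `0 < ν < 1`, with `0 < E_l ≤ ε_F(Δ₂, a₁, b₁, c₂; ν)` and `ε_F(Δ₁, a₂, b₂, c₁; ν) ≤ E_h` (two POINT brackets):
  **`dWeightNodeCF(Δ₁, a₁, b₂ − c₁; E_h) ≤ w_node(θ; ε_F(θ; ν)) ≤ dWeightNodeCF(Δ₂, a₂, b₁ − c₂; E_l)`** (`dWeightNode_fermiEnergyOf_mem_Icc_of_mem_box`) — the energy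
  channel (ε_F ↓ in Δ, ↑ in t_pd and t_pp, ↓ in t_pp′, `EmeryFermiEnergyBoxCorners`) and the fixed-energy channel are decoupled, so the rule is a (sound) ENCLOSURE,
  not the exact image; it tightens under any Δ-split of the box (the instances use the Δ-level-tag sub-boxes of §B.89).

Sources: three-band model [HybertsenSchluterChristensen1989, Eq. (1)]; nodal two-level decoupling [AndersenEtAl1995, §6, Eq. (24)]; [folklore] algebra.
-/

noncomputable section

namespace Summit.Ventures.CertifiedManyBodySolver.Downfold.Emery

open Real Set

/-! ## §1 The closed form as a function -/

/-- `dWeightNodeCF Δ t_pd g ε = 2t_pd²(Δ + ε)/(2t_pd²(Δ + 2ε) + gε²)` — the nodal Cu-d weight as a function of `(Δ, t_pd, g = t_pp − t_pp′, ε)`. [folklore] -/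
def dWeightNodeCF (Δ tpd g ε : ℝ) : ℝ := 2 * tpd ^ 2 * (Δ + ε) / (2 * tpd ^ 2 * (Δ + 2 * ε) + g * ε ^ 2)

/-- `dWeightNode = dWeightNodeCF(Δ, t_pd, t_pp − t_pp′, ε)` in the regime `Δ ≥ 0`, `0 ≤ t_pp′ ≤ t_pp`, `ε > 0`, `t_pd ≠ 0`. [folklore] -/
theorem dWeightNode_eq_CF {Δ tpd tpp c ε : ℝ} (hΔ : 0 ≤ Δ) (hc : 0 ≤ c) (hg : c ≤ tpp) (hε : 0 < ε) (htpd : tpd ≠ 0) :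
    dWeightNode Δ tpd tpp c ε = dWeightNodeCF Δ tpd (tpp - c) ε := by
  rw [dWeightNode_eq hΔ hc hg hε htpd]; rfl

/-- The denominator is positive for `Δ > 0`, `ε ≥ 0`, `g ≥ 0`, `t_pd ≠ 0`. [folklore] -/
theorem dWeightNodeCF_den_pos {Δ tpd g ε : ℝ} (hΔ : 0 < Δ) (hε : 0 ≤ ε) (hg : 0 ≤ g) (htpd : tpd ≠ 0) :
    0 < 2 * tpd ^ 2 * (Δ + 2 * ε) + g * ε ^ 2 := by
  have ht : 0 < tpd ^ 2 := lt_of_le_of_ne (sq_nonneg _) (Ne.symm (pow_ne_zero 2 htpd))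
  have : 0 ≤ g * ε ^ 2 := mul_nonneg hg (sq_nonneg _)
  positivity

/-- `0 < dWeightNodeCF` in the regime. [folklore] -/
theorem dWeightNodeCF_pos {Δ tpd g ε : ℝ} (hΔ : 0 < Δ) (hε : 0 ≤ ε) (hg : 0 ≤ g) (htpd : tpd ≠ 0) : 0 < dWeightNodeCF Δ tpd g ε := by
  have ht : 0 < tpd ^ 2 := lt_of_le_of_ne (sq_nonneg _) (Ne.symm (pow_ne_zero 2 htpd))
  unfold dWeightNodeCF
  exact div_pos (by positivity) (dWeightNodeCF_den_pos hΔ hε hg htpd)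

/-- `dWeightNodeCF ≤ 1` in the regime (`≤` with equality only at `ε = 0`). [folklore] -/
theorem dWeightNodeCF_le_one {Δ tpd g ε : ℝ} (hΔ : 0 < Δ) (hε : 0 ≤ ε) (hg : 0 ≤ g) (htpd : tpd ≠ 0) : dWeightNodeCF Δ tpd g ε ≤ 1 := by
  have ht : 0 < tpd ^ 2 := lt_of_le_of_ne (sq_nonneg _) (Ne.symm (pow_ne_zero 2 htpd))
  unfold dWeightNodeCF
  rw [div_le_one (dWeightNodeCF_den_pos hΔ hε hg htpd)]
  nlinarith [mul_nonneg hg (sq_nonneg ε), mul_nonneg ht.le hε]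

/-! ## §2 The levers -/

/-- **Δ-lever**: at fixed `(t_pd, g, ε)` the nodal weight is non-decreasing in `Δ` (`Δ, Δ′ > 0`, `ε, g ≥ 0`). [folklore] -/
theorem dWeightNodeCF_mono_Delta {Δ Δ' tpd g ε : ℝ} (hΔ : 0 < Δ) (hΔΔ : Δ ≤ Δ') (hε : 0 ≤ ε) (hg : 0 ≤ g) (htpd : tpd ≠ 0) :
    dWeightNodeCF Δ tpd g ε ≤ dWeightNodeCF Δ' tpd g ε := by
  have ht : 0 < tpd ^ 2 := lt_of_le_of_ne (sq_nonneg _) (Ne.symm (pow_ne_zero 2 htpd))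
  have hD := dWeightNodeCF_den_pos hΔ hε hg htpd
  have hD' := dWeightNodeCF_den_pos (lt_of_lt_of_le hΔ hΔΔ) hε hg htpd
  unfold dWeightNodeCF
  rw [div_le_div_iff₀ hD hD']
  have key : 2 * tpd ^ 2 * (Δ + ε) * (2 * tpd ^ 2 * (Δ' + 2 * ε) + g * ε ^ 2) -
      2 * tpd ^ 2 * (Δ' + ε) * (2 * tpd ^ 2 * (Δ + 2 * ε) + g * ε ^ 2) =
      -(2 * tpd ^ 2 * ε * (Δ' - Δ) * (2 * tpd ^ 2 + g * ε)) := by ring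
  have hnn : 0 ≤ 2 * tpd ^ 2 * ε * (Δ' - Δ) * (2 * tpd ^ 2 + g * ε) := by
    have : 0 ≤ Δ' - Δ := sub_nonneg.2 hΔΔ
    have : 0 ≤ 2 * tpd ^ 2 + g * ε := by positivity
    positivity
  linarith

/-- **t_pd-lever**: at fixed `(Δ, g, ε)` the nodal weight is non-decreasing in `t_pd` (`0 < t_pd ≤ t_pd′`; `Δ > 0`, `ε, g ≥ 0`). [folklore] -/
theorem dWeightNodeCF_mono_tpd {Δ tpd tpd' g ε : ℝ} (hΔ : 0 < Δ) (htpd : 0 < tpd) (htt : tpd ≤ tpd') (hε : 0 ≤ ε) (hg : 0 ≤ g) :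
    dWeightNodeCF Δ tpd g ε ≤ dWeightNodeCF Δ tpd' g ε := by
  have htpd' : 0 < tpd' := lt_of_lt_of_le htpd htt
  have hD := dWeightNodeCF_den_pos hΔ hε hg htpd.ne'
  have hD' := dWeightNodeCF_den_pos hΔ hε hg htpd'.ne'
  have hTT : tpd ^ 2 ≤ tpd' ^ 2 := by nlinarith
  unfold dWeightNodeCF
  rw [div_le_div_iff₀ hD hD']
  have key : 2 * tpd ^ 2 * (Δ + ε) * (2 * tpd' ^ 2 * (Δ + 2 * ε) + g * ε ^ 2) -
      2 * tpd' ^ 2 * (Δ + ε) * (2 * tpd ^ 2 * (Δ + 2 * ε) + g * ε ^ 2) =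
      -(2 * (Δ + ε) * (g * ε ^ 2) * (tpd' ^ 2 - tpd ^ 2)) := by ring
  have hnn : 0 ≤ 2 * (Δ + ε) * (g * ε ^ 2) * (tpd' ^ 2 - tpd ^ 2) := by
    have : 0 ≤ tpd' ^ 2 - tpd ^ 2 := sub_nonneg.2 hTT
    have : 0 ≤ g * ε ^ 2 := mul_nonneg hg (sq_nonneg _)
    have : 0 ≤ Δ + ε := by linarith
    positivity
  linarith

/-- **oxygen-difference lever**: at fixed `(Δ, t_pd, ε)` the nodal weight is non-increasing in `g = t_pp − t_pp′` (`0 ≤ g ≤ g′`): more O–O dispersion along the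
diagonal ⇒ a less Cu-like nodal state. Hence ↓ in `t_pp` and ↑ in `t_pp′` separately. [folklore] -/
theorem dWeightNodeCF_anti_g {Δ tpd g g' ε : ℝ} (hΔ : 0 < Δ) (hg : 0 ≤ g) (hgg : g ≤ g') (hε : 0 ≤ ε) (htpd : tpd ≠ 0) :
    dWeightNodeCF Δ tpd g' ε ≤ dWeightNodeCF Δ tpd g ε := by
  have ht : 0 < tpd ^ 2 := lt_of_le_of_ne (sq_nonneg _) (Ne.symm (pow_ne_zero 2 htpd))
  have hD := dWeightNodeCF_den_pos hΔ hε hg htpd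
  have hD' := dWeightNodeCF_den_pos hΔ hε (hg.trans hgg) htpd
  unfold dWeightNodeCF
  rw [div_le_div_iff₀ hD' hD]
  have key : 2 * tpd ^ 2 * (Δ + ε) * (2 * tpd ^ 2 * (Δ + 2 * ε) + g * ε ^ 2) -
      2 * tpd ^ 2 * (Δ + ε) * (2 * tpd ^ 2 * (Δ + 2 * ε) + g' * ε ^ 2) =
      -(2 * tpd ^ 2 * (Δ + ε) * ε ^ 2 * (g' - g)) := by ring
  have hnn : 0 ≤ 2 * tpd ^ 2 * (Δ + ε) * ε ^ 2 * (g' - g) := by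
    have : 0 ≤ g' - g := sub_nonneg.2 hgg
    have : 0 ≤ Δ + ε := by linarith
    positivity
  linarith

/-- **energy lever** (closed-form version of `dWeightNode_strictAnti`, non-strict, from `ε₁ ≥ 0`): `0 ≤ ε₁ ≤ ε₂ ⇒ dWeightNodeCF(ε₂) ≤ dWeightNodeCF(ε₁)`
(`Δ > 0`, `g ≥ 0`, `t_pd ≠ 0`). [folklore] -/
theorem dWeightNodeCF_anti_eps {Δ tpd g ε₁ ε₂ : ℝ} (hΔ : 0 < Δ) (hg : 0 ≤ g) (htpd : tpd ≠ 0) (h1 : 0 ≤ ε₁) (h12 : ε₁ ≤ ε₂) :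
    dWeightNodeCF Δ tpd g ε₂ ≤ dWeightNodeCF Δ tpd g ε₁ := by
  have ht : 0 < tpd ^ 2 := lt_of_le_of_ne (sq_nonneg _) (Ne.symm (pow_ne_zero 2 htpd))
  have h2 : 0 ≤ ε₂ := h1.trans h12
  have hD1 := dWeightNodeCF_den_pos hΔ h1 hg htpd
  have hD2 := dWeightNodeCF_den_pos hΔ h2 hg htpd
  unfold dWeightNodeCF
  rw [div_le_div_iff₀ hD2 hD1]
  have key : 2 * tpd ^ 2 * (Δ + ε₁) * (2 * tpd ^ 2 * (Δ + 2 * ε₂) + g * ε₂ ^ 2)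
      - 2 * tpd ^ 2 * (Δ + ε₂) * (2 * tpd ^ 2 * (Δ + 2 * ε₁) + g * ε₁ ^ 2)
      = 2 * tpd ^ 2 * (ε₂ - ε₁) * (2 * tpd ^ 2 * Δ + g * (Δ * (ε₁ + ε₂) + ε₁ * ε₂)) := by ring
  have hnn : 0 ≤ 2 * tpd ^ 2 * (ε₂ - ε₁) * (2 * tpd ^ 2 * Δ + g * (Δ * (ε₁ + ε₂) + ε₁ * ε₂)) := by
    have : 0 ≤ ε₂ - ε₁ := sub_nonneg.2 h12
    have : 0 ≤ g * (Δ * (ε₁ + ε₂) + ε₁ * ε₂) := by positivity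
    positivity
  linarith

/-- The four fixed-energy levers chained: `Δ ≤ Δ′`, `t_pd ≤ t_pd′`, `g′ ≤ g` ⇒ `dWeightNodeCF(Δ, t_pd, g; ε) ≤ dWeightNodeCF(Δ′, t_pd′, g′; ε)`. [folklore] -/
theorem dWeightNodeCF_mono_corner {Δ Δ' tpd tpd' g g' ε : ℝ} (hΔ : 0 < Δ) (hΔΔ : Δ ≤ Δ') (htpd : 0 < tpd) (htt : tpd ≤ tpd') (hg' : 0 ≤ g')
    (hgg : g' ≤ g) (hε : 0 ≤ ε) :
    dWeightNodeCF Δ tpd g ε ≤ dWeightNodeCF Δ' tpd' g' ε := by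
  have hΔ' : 0 < Δ' := lt_of_lt_of_le hΔ hΔΔ
  have htpd' : 0 < tpd' := lt_of_lt_of_le htpd htt
  calc dWeightNodeCF Δ tpd g ε ≤ dWeightNodeCF Δ' tpd g ε := dWeightNodeCF_mono_Delta hΔ hΔΔ hε (hg'.trans hgg) htpd.ne'
    _ ≤ dWeightNodeCF Δ' tpd' g ε := dWeightNodeCF_mono_tpd hΔ' htpd htt hε (hg'.trans hgg)
    _ ≤ dWeightNodeCF Δ' tpd' g' ε := dWeightNodeCF_anti_g hΔ' hg' hgg hε htpd'.ne'

/-! ## §3 The two-corner rule over a typed box -/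

/-- **TWO-CORNER RULE FOR THE NODAL FERMI-SURFACE Cu-d WEIGHT OF A TYPED BOX.** For every member `θ = (Δ, t_pd, t_pp, t_pp′)` of
`[Δ₁, Δ₂] × [a₁, a₂] × [b₁, b₂] × [c₁, c₂]` (`Δ₁ > 0`, `a₁ > 0`, `0 ≤ c₁`, `c₂ ≤ b₁`) at filling `0 < ν < 1`, given numbers `0 < E_l ≤ ε_F(Δ₂, a₁, b₁, c₂; ν)` and
`ε_F(Δ₁, a₂, b₂, c₁; ν) ≤ E_h`: **`dWeightNodeCF(Δ₁, a₁, b₂ − c₁; E_h) ≤ dWeightNode(θ; ε_F(θ; ν)) ≤ dWeightNodeCF(Δ₂, a₂, b₁ − c₂; E_l)`.** [folklore] -/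
theorem dWeightNode_fermiEnergyOf_mem_Icc_of_mem_box {Δ a b c Δ₁ Δ₂ a₁ a₂ b₁ b₂ c₁ c₂ ν El Eh : ℝ} (hΔ₁ : 0 < Δ₁) (ha₁ : 0 < a₁) (hc₁ : 0 ≤ c₁)
    (hcb : c₂ ≤ b₁) (hΔ : Δ ∈ Icc Δ₁ Δ₂) (ha : a ∈ Icc a₁ a₂) (hb : b ∈ Icc b₁ b₂) (hc : c ∈ Icc c₁ c₂) (hν0 : 0 < ν) (hν1 : ν < 1)
    (hEl0 : 0 < El) (hEl : El ≤ fermiEnergyOf Δ₂ a₁ b₁ c₂ ν) (hEh : fermiEnergyOf Δ₁ a₂ b₂ c₁ ν ≤ Eh) :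
    dWeightNode Δ a b c (fermiEnergyOf Δ a b c ν) ∈ Icc (dWeightNodeCF Δ₁ a₁ (b₂ - c₁) Eh) (dWeightNodeCF Δ₂ a₂ (b₁ - c₂) El) := by
  have hΔ0 : 0 < Δ := lt_of_lt_of_le hΔ₁ hΔ.1
  have ha0 : 0 < a := lt_of_lt_of_le ha₁ ha.1
  have hc0 : 0 ≤ c := hc₁.trans hc.1
  have hcb' : c ≤ b := (hc.2.trans hcb).trans hb.1
  have hb₁ : 0 ≤ b₁ := (hc₁.trans hc.1).trans (hc.2.trans hcb)
  have hbox := fermiEnergyOf_mem_Icc_of_mem_box' hΔ₁ ha₁ hb₁ hc₁ hΔ ha hb hc hν0 hν1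
  set E := fermiEnergyOf Δ a b c ν with hE
  have hEl' : El ≤ E := hEl.trans hbox.1
  have hEh' : E ≤ Eh := hbox.2.trans hEh
  have hE0 : 0 < E := lt_of_lt_of_le hEl0 hEl'
  rw [dWeightNode_eq_CF hΔ0.le hc0 hcb' hE0 ha0.ne']
  have hg0 : 0 ≤ b - c := sub_nonneg.2 hcb'
  have hglo : b₁ - c₂ ≤ b - c := by linarith [hb.1, hc.2]
  have hghi : b - c ≤ b₂ - c₁ := by linarith [hb.2, hc.1]
  have hg1 : 0 ≤ b₁ - c₂ := sub_nonneg.2 hcb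
  constructor
  · calc dWeightNodeCF Δ₁ a₁ (b₂ - c₁) Eh ≤ dWeightNodeCF Δ₁ a₁ (b₂ - c₁) E :=
          dWeightNodeCF_anti_eps hΔ₁ (hg0.trans hghi) ha₁.ne' hE0.le hEh'
      _ ≤ dWeightNodeCF Δ a (b - c) E := dWeightNodeCF_mono_corner hΔ₁ hΔ.1 ha₁ ha.1 hg0 hghi hE0.le
  · calc dWeightNodeCF Δ a (b - c) E ≤ dWeightNodeCF Δ₂ a₂ (b₁ - c₂) E :=
          dWeightNodeCF_mono_corner hΔ0 hΔ.2 ha0 ha.2 hg1 hglo hE0.le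
      _ ≤ dWeightNodeCF Δ₂ a₂ (b₁ - c₂) El :=
          dWeightNodeCF_anti_eps (lt_of_lt_of_le hΔ0 hΔ.2) hg1 (lt_of_lt_of_le ha0 ha.2).ne' hEl0.le hEl'

/-- **Numeric form** (for instances): with rational corner bounds checked by `norm_num [dWeightNodeCF]`, `w_node(θ; ε_F) ∈ [lo, hi]` for every member. [folklore] -/
theorem dWeightNode_fermiEnergyOf_mem_Icc_of_mem_box_num {Δ a b c Δ₁ Δ₂ a₁ a₂ b₁ b₂ c₁ c₂ ν El Eh lo hi : ℝ} (hΔ₁ : 0 < Δ₁) (ha₁ : 0 < a₁)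
    (hc₁ : 0 ≤ c₁) (hcb : c₂ ≤ b₁) (hΔ : Δ ∈ Icc Δ₁ Δ₂) (ha : a ∈ Icc a₁ a₂) (hb : b ∈ Icc b₁ b₂) (hc : c ∈ Icc c₁ c₂) (hν0 : 0 < ν) (hν1 : ν < 1)
    (hEl0 : 0 < El) (hEl : El ≤ fermiEnergyOf Δ₂ a₁ b₁ c₂ ν) (hEh : fermiEnergyOf Δ₁ a₂ b₂ c₁ ν ≤ Eh)
    (hlo : lo ≤ dWeightNodeCF Δ₁ a₁ (b₂ - c₁) Eh) (hhi : dWeightNodeCF Δ₂ a₂ (b₁ - c₂) El ≤ hi) :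
    dWeightNode Δ a b c (fermiEnergyOf Δ a b c ν) ∈ Icc lo hi := by
  have h := dWeightNode_fermiEnergyOf_mem_Icc_of_mem_box hΔ₁ ha₁ hc₁ hcb hΔ ha hb hc hν0 hν1 hEl0 hEl hEh
  exact ⟨hlo.trans h.1, h.2.trans hhi⟩

end Summit.Ventures.CertifiedManyBodySolver.Downfold.Emery
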